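import Summits.NavierStokesRegularity.NavierStokesRegularity.Theorems.StrainDoorsDirectionCoherence
import Summits.NavierStokesRegularity.NavierStokesRegularity.Theorems.StrainDoorsNearRecordLaw
import HarnessLib

/-!
# StrainDoorsDirectionDoorK5 — PART M §M16: DOOR K5 TYPED — DIRECTION COHERENCE OVER `R` PARABOLIC UNITS ⇒ TYPE-I
# LIOUVILLE, MODULO THE PEAK RIGIDITY «PeakDirectionSpread»

nsreg-p1 g36, ROUND-64 (helper lane of `stmt-NavierStokesRegularity-0056`, rung N0; 0 ledger writes by the
planner — text for the S-lane to land `--supports stmt-NavierStokesRegularity-0056 --as helper`; tree file 4 of 4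
of ROUND-64; bodies farm-certified inside `r64/StrainDoorsR64All.lean`, rc 0 · 0 warn · 0 sorry, std axioms).

The direction criteria (Constantin–Fefferman 1993; Beirão da Veiga–Berselli 2002; Giga–Miura 2011 for Type I;
arXiv:2501.08976 Thm 1.1 for double cones) ask for coherence of `ξ = ω/|ω|` at a FIXED spatial scale; §M14
(`StrainDoorsDirectionCoherence`) gives it for free only over `≪ (W − δ)/K` PARABOLIC units.  This file types the
gap as a door in the PART K format (`StrainDoorsPeakDoors`):

* `ParabolicDirectionCoherence θ R m u` — the SCALE-INVARIANT two-point hypothesis on `u`: directions `θ`-close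
  for points of scale-invariant vorticity `> m` at parabolic distance `≤ R`; invariant under `nsRescale`
  (`parabolicDirectionCoherence_nsRescale`); holds for free with `θ = 3KR/m`
  (`parabolicDirectionCoherence_of_typeI`);
* `PeakDirectionSpread C₀ θ R m` — door K-ε: every tangent peak has two `m`-high points within `R` whose
  directions differ by `> θ` (NOT proved; the rigidity of blow-up profiles the Giga–Miura Liouville step suggests);
* ★★★ `curl_eq_zero_of_typeI_of_directionCoherence`, `eq_zero_of_typeI_of_directionCoherence` — the
  KERNEL-CHECKED REDUCTION: door + hypothesis ⇒ `u ≡ 0`, by transferring the two-point hypothesis to the peak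
  through the pointwise convergence of rescaled curls (`isTypeITangentPeak_of_typeI`) and the continuity of
  `a ↦ a/|a|` away from `0`.  [new-as-typed]
-/

noncomputable section

open MeasureTheory Set Function Filter Metric Real InnerProductSpace
open _root_.Topology
open scoped ENNReal NNReal RealInnerProductSpace ContDiff Laplacian
open Literature.Analysis Literature.Analysis.FluidPDE
open Literature.Analysis.FluidPDE.VorticityDirectionDynamics

set_option linter.dupNamespace false
set_option maxSynthPendingDepth 3

namespace Summit.NavierStokesRegularity.NavierStokesRegularity.Theorems.StrainDoors

open Summit.NavierStokesRegularity.NavierStokesRegularity.Theorems.ArgmaxDoors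


/-! ## §M16 Door K5 typed: direction coherence over `R` parabolic units ⇒ Type-I Liouville, modulo the peak
rigidity «PeakDirectionSpread»

§M14 shows the vorticity direction of a Type-I flow is coherent for free over `≪ (W − δ)/K` parabolic units
around a near-record.  The direction criteria (Constantin–Fefferman 1993; Beirão da Veiga–Berselli 2002;
Giga–Miura 2011 for Type I; arXiv:2501.08976 Thm 1.1, double cones) need coherence at a FIXED scale, i.e. over
`R → ∞` parabolic units as `t → 0`.  The typed door in PART K format: a SCALE-INVARIANT coherence hypothesis on
`u` (directions `θ`-close over `R` parabolic units on the set of scale-invariant vorticity `> m`) transfers to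
every tangent peak by the pointwise convergence of rescaled curls (`isTypeITangentPeak_of_typeI`); the RIGIDITY
statement «every peak spreads its direction by more than `θ` within `R` units on `{|ω̄| > m}`» then empties the
near-record set, and the Type-I Liouville theorem `u ≡ 0` follows.  The rigidity is NOT proved (door K5). -/

-- LANDING NOTE (ns-s30-p1 g6): the text's helper `inv_norm_smul_smul_of_pos` (positive rescaling does not change a
-- direction) restates the landed `…Theorems.inv_norm_smul_smul_of_pos` of a ClockStretchingLaw module (gate
-- `dedup.landed`); importing that module would pull the ClockStretchingLaw theses cone and eight heavy modules into
-- door K5, so the three-line computation is inlined as a local `have` at its single use site below.  All other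
-- declarations (the 4 defs and the 7 remaining theorems, in particular every ★ statement) are byte-identical to
-- nsreg-p1 g36's r64 text (sha16 a6c23bc59b3e4d37).

/-- K5 hypothesis on `u` «ParabolicDirectionCoherence» `(θ, R, m)`: at every time `t < 0`, any two points of
scale-invariant vorticity `(0 − t)|ω| > m` at parabolic distance `≤ R` (i.e. `|y − x| ≤ R√(0 − t)`) have
directions `θ`-close.  SCALE-INVARIANT (`parabolicDirectionCoherence_nsRescale`).  By §M14 it holds for free with
`θ = K·R/m`; the door has content for `θ ≪ KR/m`. -/
def ParabolicDirectionCoherence (θ R m : ℝ)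
    (u : ℝ → (EuclideanSpace ℝ (Fin 3)) → (EuclideanSpace ℝ (Fin 3))) : Prop :=
  ∀ t : ℝ, t < 0 → ∀ x y : EuclideanSpace ℝ (Fin 3),
    m < (0 - t) * ‖curl (u t) x‖ → m < (0 - t) * ‖curl (u t) y‖ → ‖y - x‖ ≤ R * √(0 - t) →
      ‖vorticityDirection (curl (u t)) y - vorticityDirection (curl (u t)) x‖ ≤ θ

/-- door K-ε «PeakDirectionSpread» `(C₀, θ, R, m)`: every Type-I tangent peak with constant `C₀` has, at time `−1`,
two points of vorticity `> m` within distance `R` of each other whose directions differ by MORE than `θ`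
(RIGIDITY of blow-up profiles: no peak is `θ`-unidirectional over `R` units on its `m`-high set; cf. the
Giga–Miura Liouville step, which kills exactly the unidirectional bounded ancient flows).  Not proved here. -/
def PeakDirectionSpread (C₀ θ R m : ℝ) : Prop :=
  ∀ (v : ℝ → (EuclideanSpace ℝ (Fin 3)) → (EuclideanSpace ℝ (Fin 3))) (zbar : EuclideanSpace ℝ (Fin 3)),
    IsTypeITangentPeak C₀ v zbar →
      ∃ y y' : EuclideanSpace ℝ (Fin 3), m < ‖curl (v (-1)) y‖ ∧ m < ‖curl (v (-1)) y'‖ ∧ ‖y' - y‖ ≤ R ∧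
        θ < ‖vorticityDirection (curl (v (-1))) y' - vorticityDirection (curl (v (-1))) y‖

/-- The K5 hypothesis is invariant under the Navier–Stokes rescaling `u_λ(s,y) = λu(λ²s, λy)`, `λ > 0`. -/
theorem parabolicDirectionCoherence_nsRescale {θ R m lam : ℝ} (hlam : 0 < lam)
    {u : ℝ → (EuclideanSpace ℝ (Fin 3)) → (EuclideanSpace ℝ (Fin 3))}
    (h : ParabolicDirectionCoherence θ R m u) :
    ParabolicDirectionCoherence θ R m (nsRescale lam u) := by
  intro s hs z z' hz hz' hd
  have ht : lam ^ 2 * s < 0 := mul_neg_of_pos_of_neg (by positivity) hs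
  have hcurl : ∀ y : EuclideanSpace ℝ (Fin 3),
      curl (nsRescale lam u s) y = lam ^ 2 • curl (u (lam ^ 2 * s)) (lam • y) := fun y => by
    rw [curl_eq_curlCLM, curl_eq_curlCLM, fderiv_nsRescale, map_smul]
  have hdir : ∀ y : EuclideanSpace ℝ (Fin 3), vorticityDirection (curl (nsRescale lam u s)) y =
      vorticityDirection (curl (u (lam ^ 2 * s))) (lam • y) := fun y => by
    have hinv : ∀ {c : ℝ} (hc : 0 < c) (a : EuclideanSpace ℝ (Fin 3)), ‖c • a‖⁻¹ • (c • a) = ‖a‖⁻¹ • a := by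
      intro c hc a
      by_cases ha : a = 0
      · simp [ha]
      · rw [norm_smul, Real.norm_of_nonneg hc.le, mul_inv, smul_smul]
        congr 1
        rw [mul_assoc, mul_comm ‖a‖⁻¹ c, ← mul_assoc, inv_mul_cancel₀ hc.ne', one_mul]
    rw [vorticityDirection_apply, vorticityDirection_apply, hcurl, hinv (by positivity)]
  rw [vorticityNumber_nsRescale] at hz hz'
  have hsq : √(0 - lam ^ 2 * s) = lam * √(0 - s) := by
    rw [show 0 - lam ^ 2 * s = lam ^ 2 * (0 - s) by ring, Real.sqrt_mul (sq_nonneg lam), Real.sqrt_sq hlam.le]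
  have hd' : ‖lam • z' - lam • z‖ ≤ R * √(0 - lam ^ 2 * s) := by
    rw [← smul_sub, norm_smul, Real.norm_of_nonneg hlam.le, hsq, mul_left_comm]
    exact mul_le_mul_of_nonneg_left hd hlam.le
  rw [hdir, hdir]
  exact h (lam ^ 2 * s) ht (lam • z) (lam • z') hz hz' hd'

/-- ★★★ **K5 REDUCTION (kernel-checked door composition): coherence over `R` parabolic units on `u` + the peak
rigidity «PeakDirectionSpread» ⇒ `ω ≡ 0`.**  Transfer of the scale-invariant two-point hypothesis to the tangent
peak by the pointwise convergence of rescaled curls at the two spread points (`isTypeITangentPeak_of_typeI`), and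
continuity of `a ↦ a/|a|` away from `0`. -/
theorem curl_eq_zero_of_typeI_of_directionCoherence {C₀ θ R m : ℝ} (hm : 0 ≤ m)
    (hK5 : PeakDirectionSpread C₀ θ R m)
    {u : ℝ → (EuclideanSpace ℝ (Fin 3)) → (EuclideanSpace ℝ (Fin 3))} {p : ℝ → (EuclideanSpace ℝ (Fin 3)) → ℝ}
    (hsol : IsClassicalNSSolutionOn (Iio 0) 1 0 u p) (hI : HasTypeIDecay C₀ u)
    (hcoh : ParabolicDirectionCoherence θ R m u) :
    ∀ t : ℝ, t < 0 → ∀ x : EuclideanSpace ℝ (Fin 3), curl (u t) x = 0 := by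
  by_contra hne
  push Not at hne
  obtain ⟨t₀, ht₀, x₀, hx₀⟩ := hne
  obtain ⟨v, zbar, hP, -, lam, hlam, hconv⟩ := isTypeITangentPeak_of_typeI hsol hI ⟨t₀, ht₀, x₀, hx₀⟩
  obtain ⟨y, y', hy, hy', hyy, hθ⟩ := hK5 v zbar hP
  have h1 : (-1 : ℝ) ≤ -(1 / 4 : ℝ) := by norm_num
  -- the rescaled curls at the two points converge
  have hcy := (hconv (-1) h1 y).2.2
  have hcy' := (hconv (-1) h1 y').2.2
  have ha0 : curl (v (-1)) y ≠ 0 := fun h0 => by rw [h0, norm_zero] at hy; linarith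
  have ha0' : curl (v (-1)) y' ≠ 0 := fun h0 => by rw [h0, norm_zero] at hy'; linarith
  -- directions converge (continuity of `a ↦ ‖a‖⁻¹ • a` at `a ≠ 0`)
  have hdy : Tendsto (fun j => vorticityDirection (curl (nsRescale (lam j) u (-1))) y) atTop
      (𝓝 (vorticityDirection (curl (v (-1))) y)) := by
    simp only [vorticityDirection_apply]
    exact ((tendsto_norm.comp hcy).inv₀ (norm_ne_zero_iff.mpr ha0)).smul hcy
  have hdy' : Tendsto (fun j => vorticityDirection (curl (nsRescale (lam j) u (-1))) y') atTop
      (𝓝 (vorticityDirection (curl (v (-1))) y')) := by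
    simp only [vorticityDirection_apply]
    exact ((tendsto_norm.comp hcy').inv₀ (norm_ne_zero_iff.mpr ha0')).smul hcy'
  have hD : Tendsto (fun j => ‖vorticityDirection (curl (nsRescale (lam j) u (-1))) y' -
      vorticityDirection (curl (nsRescale (lam j) u (-1))) y‖) atTop
      (𝓝 ‖vorticityDirection (curl (v (-1))) y' - vorticityDirection (curl (v (-1))) y‖) :=
    tendsto_norm.comp (hdy'.sub hdy)
  -- eventually both rescaled vorticities exceed `m`, so the (scale-invariant) coherence of `u` applies
  have hev : ∀ᶠ j in atTop, m < ‖curl (nsRescale (lam j) u (-1)) y‖ :=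
    (tendsto_norm.comp hcy).eventually (lt_mem_nhds hy)
  have hev' : ∀ᶠ j in atTop, m < ‖curl (nsRescale (lam j) u (-1)) y'‖ :=
    (tendsto_norm.comp hcy').eventually (lt_mem_nhds hy')
  have hle : ∀ᶠ j in atTop, ‖vorticityDirection (curl (nsRescale (lam j) u (-1))) y' -
      vorticityDirection (curl (nsRescale (lam j) u (-1))) y‖ ≤ θ := by
    filter_upwards [hev, hev'] with j hj hj'
    have hcj := parabolicDirectionCoherence_nsRescale (hlam j) hcoh
    refine hcj (-1) (by norm_num) y y' ?_ ?_ ?_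
    · rw [show (0:ℝ) - (-1) = 1 by norm_num, one_mul]; exact hj
    · rw [show (0:ℝ) - (-1) = 1 by norm_num, one_mul]; exact hj'
    · rw [show (0:ℝ) - (-1) = 1 by norm_num, Real.sqrt_one, mul_one]; exact hyy
  have := le_of_tendsto hD hle
  linarith

/-- ★★★ **DOOR K5 ⇒ THE TYPE-I LIOUVILLE THEOREM for coherent flows**: under «PeakDirectionSpread» `(C₀, θ, R, m)`,
every classical Type-I ancient solution (constant `C₀`) whose vorticity directions are `θ`-coherent over `R`
parabolic units on `{(0 − t)|ω| > m}` VANISHES IDENTICALLY (`curl ≡ 0` + the R62 tree lemma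
`eq_zero_of_typeI_of_curl_eq_zero`: irrotational + divergence-free + bounded + Type-I decay ⇒ `0`). -/
theorem eq_zero_of_typeI_of_directionCoherence {C₀ θ R m : ℝ} (hm : 0 ≤ m)
    (hK5 : PeakDirectionSpread C₀ θ R m)
    {u : ℝ → (EuclideanSpace ℝ (Fin 3)) → (EuclideanSpace ℝ (Fin 3))} {p : ℝ → (EuclideanSpace ℝ (Fin 3)) → ℝ}
    (hsol : IsClassicalNSSolutionOn (Iio 0) 1 0 u p) (hI : HasTypeIDecay C₀ u)
    (hcoh : ParabolicDirectionCoherence θ R m u) :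
    ∀ t : ℝ, t < 0 → ∀ x : EuclideanSpace ℝ (Fin 3), u t x = 0 :=
  eq_zero_of_typeI_of_curl_eq_zero hsol hI (curl_eq_zero_of_typeI_of_directionCoherence hm hK5 hsol hI hcoh)

/-- ★★ **What §M14 gives toward K5 for free**: the hypothesis `ParabolicDirectionCoherence (3K·R/m) R m` holds for
EVERY classical Type-I ancient solution (`K = K(C₀)` of `typeI_vorticityDirection_coherence`, `m > 0`, `R ≥ 0`) —
so door K5 has content exactly in the regime `θ < 3KR/m`: coherence finer than the class's own Lipschitz modulus
at parabolic scale. -/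
theorem parabolicDirectionCoherence_of_typeI {C₀ : ℝ} (hC₀ : 0 ≤ C₀) :
    ∃ K : ℝ, 0 ≤ K ∧
      ∀ (u : ℝ → (EuclideanSpace ℝ (Fin 3)) → (EuclideanSpace ℝ (Fin 3))) (p : ℝ → (EuclideanSpace ℝ (Fin 3)) → ℝ)
        (R m : ℝ), IsClassicalNSSolutionOn (Iio 0) 1 0 u p → HasTypeIDecay C₀ u → 0 < m → 0 ≤ R →
        ParabolicDirectionCoherence (3 * K * R / m) R m u := by
  obtain ⟨K, hK, h⟩ := typeI_vorticityDirection_coherence hC₀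
  refine ⟨K, hK, fun u p R m hsol hI hm hR t ht x y hx hy hd => ?_⟩
  have ht0 : 0 < 0 - t := by linarith
  have hs0 : 0 < √(0 - t) := Real.sqrt_pos.mpr ht0
  have hne : curl (u t) x ≠ 0 := fun h0 => by
    rw [h0, norm_zero, mul_zero] at hx; linarith
  have h1 := h u p t x y hsol hI ht hne
  rw [← mul_div_assoc, le_div_iff₀ hs0] at h1
  -- `h1 : (0 - t)|ω(x)|·D·√(0−t) ≤ K|y − x| ≤ K R √(0−t)`, and `(0 - t)|ω(x)| > m`
  set D := ‖vorticityDirection (curl (u t)) y - vorticityDirection (curl (u t)) x‖ with hDdef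
  have hD0 : 0 ≤ D := norm_nonneg _
  have h2 : (0 - t) * ‖curl (u t) x‖ * D * √(0 - t) ≤ K * (R * √(0 - t)) :=
    h1.trans (mul_le_mul_of_nonneg_left hd hK)
  have h3 : m * (D * √(0 - t)) ≤ (0 - t) * ‖curl (u t) x‖ * (D * √(0 - t)) :=
    mul_le_mul_of_nonneg_right hx.le (by positivity)
  rw [le_div_iff₀ hm]
  have h4 : D * m * √(0 - t) ≤ K * R * √(0 - t) := by nlinarith
  have h5 : D * m ≤ K * R := le_of_mul_le_mul_right h4 hs0
  nlinarith [h5, hK, hR, hD0]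

/-! ### The relative door: threshold `μ` × the record value -/

/-- K5 hypothesis on `u`, RELATIVE threshold: `θ`-coherence over `R` parabolic units on the set of scale-invariant
vorticity above `μ·W` for EVERY dominant `W` of `u` (equivalently: at threshold `μ·sup (0 − s)|ω_u|`). -/
def RelParabolicDirectionCoherence (θ R μ : ℝ)
    (u : ℝ → (EuclideanSpace ℝ (Fin 3)) → (EuclideanSpace ℝ (Fin 3))) : Prop :=
  ∀ W : ℝ, (∀ s : ℝ, s < 0 → ∀ y : EuclideanSpace ℝ (Fin 3), (0 - s) * ‖curl (u s) y‖ ≤ W) →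
    ParabolicDirectionCoherence θ R (μ * W) u

/-- door K-ε′ «PeakDirectionSpreadRel» `(C₀, θ, R, μ)`: every Type-I tangent peak `(v̄, z̄)` has, at time `−1`, two
points within `R` of each other with vorticity above `μ·|ω̄(−1,z̄)|` (= `μ` × the peak height) whose directions
differ by more than `θ`: «no blow-up profile is `θ`-unidirectional over `R` units on the part of its support
carrying a `μ`-fraction of the peak vorticity».  Not proved here. -/
def PeakDirectionSpreadRel (C₀ θ R μ : ℝ) : Prop :=
  ∀ (v : ℝ → (EuclideanSpace ℝ (Fin 3)) → (EuclideanSpace ℝ (Fin 3))) (zbar : EuclideanSpace ℝ (Fin 3)),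
    IsTypeITangentPeak C₀ v zbar →
      ∃ y y' : EuclideanSpace ℝ (Fin 3), μ * ‖curl (v (-1)) zbar‖ < ‖curl (v (-1)) y‖ ∧
        μ * ‖curl (v (-1)) zbar‖ < ‖curl (v (-1)) y'‖ ∧ ‖y' - y‖ ≤ R ∧
        θ < ‖vorticityDirection (curl (v (-1))) y' - vorticityDirection (curl (v (-1))) y‖

/-- ★★★ **K5 REDUCTION, RELATIVE THRESHOLD**: «PeakDirectionSpreadRel» `(C₀, θ, R, μ)`, `μ ≥ 0`, plus relative
`θ`-coherence of `u` over `R` parabolic units ⇒ `ω ≡ 0`.  The peak's height majorises every vorticity number of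
`u` (`isTypeITangentPeak_of_typeI`), so the `u`-side hypothesis applies at the absolute threshold
`m = μ·|ω̄(−1,z̄)|`, and the two-point transfer of §M16 runs verbatim. -/
theorem curl_eq_zero_of_typeI_of_relDirectionCoherence {C₀ θ R μ : ℝ} (hμ : 0 ≤ μ)
    (hK5 : PeakDirectionSpreadRel C₀ θ R μ)
    {u : ℝ → (EuclideanSpace ℝ (Fin 3)) → (EuclideanSpace ℝ (Fin 3))} {p : ℝ → (EuclideanSpace ℝ (Fin 3)) → ℝ}
    (hsol : IsClassicalNSSolutionOn (Iio 0) 1 0 u p) (hI : HasTypeIDecay C₀ u)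
    (hcoh : RelParabolicDirectionCoherence θ R μ u) :
    ∀ t : ℝ, t < 0 → ∀ x : EuclideanSpace ℝ (Fin 3), curl (u t) x = 0 := by
  by_contra hne
  push Not at hne
  obtain ⟨t₀, ht₀, x₀, hx₀⟩ := hne
  obtain ⟨v, zbar, hP, hnum, lam, hlam, hconv⟩ := isTypeITangentPeak_of_typeI hsol hI ⟨t₀, ht₀, x₀, hx₀⟩
  obtain ⟨y, y', hy, hy', hyy, hθ⟩ := hK5 v zbar hP
  -- the `u`-side hypothesis at the absolute threshold `m = μ · |ω̄(−1, z̄)|`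
  obtain ⟨m, hmdef⟩ : ∃ m : ℝ, m = μ * ‖curl (v (-1)) zbar‖ := ⟨_, rfl⟩
  have hm : 0 ≤ m := by rw [hmdef]; positivity
  have hcohm : ParabolicDirectionCoherence θ R m u := by
    have h := hcoh ((0 - (-1)) * ‖curl (v (-1)) zbar‖) hnum
    rw [hmdef, show μ * ‖curl (v (-1)) zbar‖ = μ * ((0 - (-1)) * ‖curl (v (-1)) zbar‖) by ring]
    exact h
  rw [← hmdef] at hy hy'
  have h1 : (-1 : ℝ) ≤ -(1 / 4 : ℝ) := by norm_num
  have hcy := (hconv (-1) h1 y).2.2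
  have hcy' := (hconv (-1) h1 y').2.2
  have ha0 : curl (v (-1)) y ≠ 0 := fun h0 => by rw [h0, norm_zero] at hy; linarith
  have ha0' : curl (v (-1)) y' ≠ 0 := fun h0 => by rw [h0, norm_zero] at hy'; linarith
  have hdy : Tendsto (fun j => vorticityDirection (curl (nsRescale (lam j) u (-1))) y) atTop
      (𝓝 (vorticityDirection (curl (v (-1))) y)) := by
    simp only [vorticityDirection_apply]
    exact ((tendsto_norm.comp hcy).inv₀ (norm_ne_zero_iff.mpr ha0)).smul hcy
  have hdy' : Tendsto (fun j => vorticityDirection (curl (nsRescale (lam j) u (-1))) y') atTop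
      (𝓝 (vorticityDirection (curl (v (-1))) y')) := by
    simp only [vorticityDirection_apply]
    exact ((tendsto_norm.comp hcy').inv₀ (norm_ne_zero_iff.mpr ha0')).smul hcy'
  have hD : Tendsto (fun j => ‖vorticityDirection (curl (nsRescale (lam j) u (-1))) y' -
      vorticityDirection (curl (nsRescale (lam j) u (-1))) y‖) atTop
      (𝓝 ‖vorticityDirection (curl (v (-1))) y' - vorticityDirection (curl (v (-1))) y‖) :=
    tendsto_norm.comp (hdy'.sub hdy)
  have hev : ∀ᶠ j in atTop, m < ‖curl (nsRescale (lam j) u (-1)) y‖ :=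
    (tendsto_norm.comp hcy).eventually (lt_mem_nhds hy)
  have hev' : ∀ᶠ j in atTop, m < ‖curl (nsRescale (lam j) u (-1)) y'‖ :=
    (tendsto_norm.comp hcy').eventually (lt_mem_nhds hy')
  have hle : ∀ᶠ j in atTop, ‖vorticityDirection (curl (nsRescale (lam j) u (-1))) y' -
      vorticityDirection (curl (nsRescale (lam j) u (-1))) y‖ ≤ θ := by
    filter_upwards [hev, hev'] with j hj hj'
    have hcj := parabolicDirectionCoherence_nsRescale (hlam j) hcohm
    refine hcj (-1) (by norm_num) y y' ?_ ?_ ?_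
    · rw [show (0:ℝ) - (-1) = 1 by norm_num, one_mul]; exact hj
    · rw [show (0:ℝ) - (-1) = 1 by norm_num, one_mul]; exact hj'
    · rw [show (0:ℝ) - (-1) = 1 by norm_num, Real.sqrt_one, mul_one]; exact hyy
  have := le_of_tendsto hD hle
  linarith

/-- ★★★ **DOOR K5 (relative) ⇒ THE TYPE-I LIOUVILLE THEOREM for relatively coherent flows.** -/
theorem eq_zero_of_typeI_of_relDirectionCoherence {C₀ θ R μ : ℝ} (hμ : 0 ≤ μ)
    (hK5 : PeakDirectionSpreadRel C₀ θ R μ)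
    {u : ℝ → (EuclideanSpace ℝ (Fin 3)) → (EuclideanSpace ℝ (Fin 3))} {p : ℝ → (EuclideanSpace ℝ (Fin 3)) → ℝ}
    (hsol : IsClassicalNSSolutionOn (Iio 0) 1 0 u p) (hI : HasTypeIDecay C₀ u)
    (hcoh : RelParabolicDirectionCoherence θ R μ u) :
    ∀ t : ℝ, t < 0 → ∀ x : EuclideanSpace ℝ (Fin 3), u t x = 0 :=
  eq_zero_of_typeI_of_curl_eq_zero hsol hI (curl_eq_zero_of_typeI_of_relDirectionCoherence hμ hK5 hsol hI hcoh)

/-- ★★ **The free regime of the relative door**: every classical Type-I ancient solution is relatively coherent with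
`θ = 3KR/(μW)`-type constants — precisely, `RelParabolicDirectionCoherence (3 * K * R / (μ * W₀)) R μ u` whenever
`W₀ > 0` is a LOWER bound for the dominants used (stated for the dominant family `W ≥ W₀`): here in the simplest
form, for each fixed dominant `W > 0`, `ParabolicDirectionCoherence (3 * K * R / (μ * W)) R (μ * W) u`. -/
theorem parabolicDirectionCoherence_of_typeI_rel {C₀ : ℝ} (hC₀ : 0 ≤ C₀) :
    ∃ K : ℝ, 0 ≤ K ∧
      ∀ (u : ℝ → (EuclideanSpace ℝ (Fin 3)) → (EuclideanSpace ℝ (Fin 3))) (p : ℝ → (EuclideanSpace ℝ (Fin 3)) → ℝ)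
        (R μ W : ℝ), IsClassicalNSSolutionOn (Iio 0) 1 0 u p → HasTypeIDecay C₀ u → 0 < μ → 0 < W → 0 ≤ R →
        ParabolicDirectionCoherence (3 * K * R / (μ * W)) R (μ * W) u := by
  obtain ⟨K, hK, h⟩ := parabolicDirectionCoherence_of_typeI hC₀
  exact ⟨K, hK, fun u p R μ W hsol hI hμ hW hR => h u p R (μ * W) hsol hI (by positivity) hR⟩

end Summit.NavierStokesRegularity.NavierStokesRegularity.Theorems.StrainDoors
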